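import Summits.AtomisticToContinuum.Crystallization.Theorems.OverbindingBudgetAffineFirmGainB

/-!
# ★ `FirmGain` PROVED — file C: L5 `crossSumBound`, the assembly `firmGain_of_lemmas` (g106 skeleton verbatim), `theorem firmGain : FirmGain`, `softGain`
(line 31280, (2c) payer leaf `…OverbindingBudgetAffineFirmDescent.FirmGain` ((464) p864425); lens-4 BRIEF-g106 / NOTE-g107, proofs `FirmGainProved.lean`
63368a6f… §6–§7 VERBATIM; landing plan crit-1 r1950 (477), landed by hand-2 g51).  With files A (475) and B (476) this CLOSES the (2c) PAYER LEAF of line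
31280 unconditionally (every window `[δ, 2]`, every `κ > 0`, `Ls ≥ 0`); `softGain` recovers the pre-r1934 payer `SoftGain` by (464) `softGain_of_firmGain`.
The line's crux of record `FirmRigidity 1` is untouched.  Imports file B only; theorems only; no instance / notation / option; 0 sorry;
`#print axioms firmGain` = `propext, Classical.choice, Quot.sound`.  `--supports stmt-AtomisticToContinuum-31280`.
-/

namespace Summit.AtomisticToContinuum.Crystallization.Theorems.OverbindingBudgetAffineFirmDescent.Brief

open scoped BigOperators Classical RealInnerProductSpace
open Literature.MathematicalPhysics.StatisticalMechanics
open Literature.Geometry.DiscreteGeometry (nearestDist nearestDist_nonneg nearestDist_le_dist)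
open Summit.AtomisticToContinuum.Crystallization.Theorems.OverbindingBudgetMisfitWindowStatements (InWindow offCount)
open Summit.AtomisticToContinuum.Crystallization.Theorems.OverbindingBudgetBalancedCensusStatements
open Summit.AtomisticToContinuum.Crystallization.Theorems.OverbindingBudgetAffineTwinCut
open Summit.AtomisticToContinuum.Crystallization.Theorems.OverbindingBudgetAffineFirmDescent
open Summit.AtomisticToContinuum.Crystallization.Theorems.FrustratedLawDichotomyNashStabilityCalculus

variable {N : ℕ}

/-! ## §6  L5 `CrossSumBound` -/

/-- **L5.1 · per-pair bound.**  From L2 with `m = ‖r‖ − 4Ls` (so `m ≥ 2 ≥ 1` and `m ≥ ‖r‖/2`): `|X(r; u, v)| ≤ 24576 · Ls² · ‖r‖⁻⁸`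
whenever `‖u‖, ‖v‖ ≤ 2Ls` and `‖r‖ ≥ 8Ls + 2`. [S] -/
theorem pair_bound (L2 : MixedDiffBound) {Ls : ℝ} (hLs : 0 ≤ Ls) {r u v : EuclideanSpace ℝ (Fin 3)}
    (hu : ‖u‖ ≤ 2 * Ls) (hv : ‖v‖ ≤ 2 * Ls) (hr : 8 * Ls + 2 ≤ ‖r‖) :
    |mixedDiff r u v| ≤ 24576 * Ls ^ 2 * ‖r‖⁻¹ ^ 8 := by
  obtain ⟨m, hm⟩ : ∃ m : ℝ, m = ‖r‖ - 4 * Ls := ⟨_, rfl⟩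
  have hm1 : 1 ≤ m := by rw [hm]; linarith
  have hm0 : 0 < m := by linarith
  have hr0 : 0 < ‖r‖ := by linarith
  have hsum : ‖u‖ + ‖v‖ + m ≤ ‖r‖ := by rw [hm]; linarith
  have hX := L2 r u v m hm1 hsum
  have hhalf : ‖r‖ / 2 ≤ m := by rw [hm]; linarith
  have hinv : m⁻¹ ≤ (‖r‖ / 2)⁻¹ := inv_anti₀ (by positivity) hhalf
  have hinv' : m⁻¹ ≤ 2 * ‖r‖⁻¹ := by
    have e : (‖r‖ / 2)⁻¹ = 2 * ‖r‖⁻¹ := by rw [inv_div, div_eq_mul_inv]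
    rw [e] at hinv
    exact hinv
  have hpow : m⁻¹ ^ 8 ≤ (2 * ‖r‖⁻¹) ^ 8 := pow_le_pow_left₀ (inv_nonneg.2 hm0.le) hinv' 8
  have hpow' : m⁻¹ ^ 8 ≤ 256 * ‖r‖⁻¹ ^ 8 := by
    have e : (2 * ‖r‖⁻¹) ^ 8 = 256 * ‖r‖⁻¹ ^ 8 := by ring
    rw [e] at hpow
    exact hpow
  have huv : ‖u‖ * ‖v‖ ≤ (2 * Ls) * (2 * Ls) := mul_le_mul hu hv (norm_nonneg _) (by positivity)
  calc |mixedDiff r u v| ≤ 24 * m⁻¹ ^ 8 * ‖u‖ * ‖v‖ := hX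
    _ = (24 * m⁻¹ ^ 8) * (‖u‖ * ‖v‖) := by ring
    _ ≤ (24 * (256 * ‖r‖⁻¹ ^ 8)) * ((2 * Ls) * (2 * Ls)) :=
        mul_le_mul (by linarith [hpow']) huv (by positivity) (by positivity)
    _ = 24576 * Ls ^ 2 * ‖r‖⁻¹ ^ 8 := by ring

/-- **L5 · `CrossSumBound`** (PROVED). -/
theorem crossSumBound : CrossSumBound := by
  intro L2 δ κ Ls hδ _hδ2 hκ hLs N y F w hs hamp hF
  -- §a  the constants `T`, `R₀ = Dsep − 4Ls`, `Q = κ·T⁵`, `M₁` (per moved site), `P₁` (moved sites per member)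
  obtain ⟨T, hT⟩ : ∃ T : ℝ, T = tailLen δ κ Ls := ⟨_, rfl⟩
  have hT0 : 0 ≤ T := by
    rw [hT]
    unfold tailLen
    exact Real.rpow_nonneg (by positivity) _
  obtain ⟨R₀, hR₀⟩ : ∃ R₀ : ℝ, R₀ = 8 * Ls + δ + 2 + T := ⟨_, rfl⟩
  have hDsep : Dsep δ κ Ls = R₀ + 4 * Ls := by
    rw [hR₀, hT]
    unfold Dsep
    ring
  have hTR : T ≤ R₀ := by rw [hR₀]; linarith
  have hR₀δ : δ ≤ R₀ := by rw [hR₀]; linarith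
  have hR₀0 : 0 < R₀ := lt_of_lt_of_le hδ hR₀δ
  have hR₀2 : 8 * Ls + 2 ≤ R₀ := by rw [hR₀]; linarith
  obtain ⟨Q, hQ⟩ : ∃ Q : ℝ, Q = 6144000 * (4 * Ls / δ + 1) ^ 3 * Ls ^ 2 / δ ^ 3 := ⟨_, rfl⟩
  have hQ0 : 0 ≤ Q := by rw [hQ]; positivity
  have hT5 : T ^ 5 = Q / κ := by
    have e : (6144000 * (4 * Ls / δ + 1) ^ 3 * Ls ^ 2 / (δ ^ 3 * κ)) = Q / κ := by rw [hQ]; ring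
    have e5 : (1 / 5 : ℝ) = ((5 : ℕ) : ℝ)⁻¹ := by norm_num
    rw [hT]
    unfold tailLen
    rw [e, e5]
    exact Real.rpow_inv_natCast_pow (div_nonneg hQ0 hκ.le) (by norm_num)
  have hQR : Q / κ ≤ R₀ ^ 5 := by
    rw [← hT5]
    exact pow_le_pow_left₀ hT0 hTR 5
  obtain ⟨M₁, hM₁⟩ : ∃ M₁ : ℝ, M₁ = 24576 * Ls ^ 2 * (250 * δ⁻¹ ^ 3 * R₀⁻¹ ^ 5) := ⟨_, rfl⟩
  have hM₁0 : 0 ≤ M₁ := by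
    rw [hM₁]
    have : 0 ≤ R₀⁻¹ := inv_nonneg.2 hR₀0.le
    have : 0 ≤ δ⁻¹ := inv_nonneg.2 hδ.le
    positivity
  obtain ⟨P₁, hP₁⟩ : ∃ P₁ : ℝ, P₁ = (2 * (2 * Ls) / δ + 1) ^ 3 := ⟨_, rfl⟩
  have hB : P₁ * M₁ ≤ κ := by
    have h1 : P₁ * M₁ = Q / R₀ ^ 5 := by
      rw [hP₁, hM₁, hQ]
      field_simp
      ring
    have h2 : Q ≤ R₀ ^ 5 * κ := by rwa [div_le_iff₀ hκ] at hQR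
    rw [h1, div_le_iff₀ (pow_pos hR₀0 5)]
    linarith [h2]
  -- §b  geometry of one member `j ∈ F`: partners (sites in the supports of the OTHER members) are in-window and farther than `R₀`
  have hpartner : ∀ j ∈ F, ∀ a ∈ supp (w j), ∀ j' ∈ F.erase j, ∀ b ∈ supp (w j'),
      δ ≤ nearestDist y b ∧ R₀ < dist (y a) (y b) := by
    intro j hj a ha j' hj' b hb
    obtain ⟨hj'ne, hj'F⟩ := Finset.mem_erase.mp hj'
    obtain ⟨hadist, _⟩ := hs j hj a (mem_supp.1 ha)
    obtain ⟨hbdist, hbwin⟩ := hs j' hj'F b (mem_supp.1 hb)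
    have hjj' : Dsep δ κ Ls < dist (y j) (y j') := hF j hj j' hj'F (Ne.symm hj'ne)
    have h4 := dist_triangle4 (y j) (y a) (y b) (y j')
    rw [hDsep] at hjj'
    rw [dist_comm (y j) (y a)] at h4
    exact ⟨hbwin.1, by linarith⟩
  -- §c  moved sites per member: `#supp (w j) ≤ P₁` (packing of `δ`-separated points in the `2Ls`-ball about `y j`)
  have hcard : ∀ j ∈ F, ((supp (w j)).card : ℝ) ≤ P₁ := by
    intro j hj
    have hwin : ∀ a ∈ supp (w j), δ ≤ nearestDist y a := fun a ha => (hs j hj a (mem_supp.1 ha)).2.1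
    have hinj : Set.InjOn y ↑(supp (w j)) := by
      intro a ha b hb hab
      by_contra hne
      have h1 := nearestDist_le_dist y (Ne.symm hne)
      rw [hab, dist_self] at h1
      linarith [hwin a ha]
    have hpack := card_le_of_separated_of_dist_le ((supp (w j)).image y) (y j) hδ (by positivity : (0 : ℝ) ≤ 2 * Ls)
      (by
        intro c hc
        obtain ⟨a, ha, rfl⟩ := Finset.mem_image.mp hc
        exact (hs j hj a (mem_supp.1 ha)).1)
      (by
        intro c hc d hd hcd
        obtain ⟨a, ha, rfl⟩ := Finset.mem_image.mp hc
        obtain ⟨b, hb, rfl⟩ := Finset.mem_image.mp hd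
        have hba : b ≠ a := fun h => hcd (by rw [h])
        exact (hwin a ha).trans (nearestDist_le_dist y hba))
    rw [Finset.card_image_of_injOn hinj, finrank_euclideanSpace_fin] at hpack
    rw [hP₁]
    exact hpack
  -- §d  per moved site `a` of member `j`: the partners' cross terms sum to `≤ M₁`
  have hsite : ∀ j ∈ F, ∀ a ∈ supp (w j),
      (∑ j' ∈ F.erase j, ∑ b ∈ supp (w j'), mixedDiff (y a - y b) (w j a) (w j' b)) ≤ M₁ := by
    intro j hj a ha
    -- termwise (L5.1)
    have hterm : ∀ j' ∈ F.erase j, ∀ b ∈ supp (w j'),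
        mixedDiff (y a - y b) (w j a) (w j' b) ≤ 24576 * Ls ^ 2 * (dist (y a) (y b))⁻¹ ^ 8 := by
      intro j' hj' b hb
      have hj'F : j' ∈ F := Finset.mem_of_mem_erase hj'
      have hab := (hpartner j hj a ha j' hj' b hb).2
      have hr : 8 * Ls + 2 ≤ ‖y a - y b‖ := by rw [← dist_eq_norm]; linarith
      have hpb := pair_bound L2 hLs (hamp j hj a) (hamp j' hj'F b) hr
      rw [← dist_eq_norm] at hpb
      exact (le_abs_self _).trans hpb
    have hsum1 : (∑ j' ∈ F.erase j, ∑ b ∈ supp (w j'), mixedDiff (y a - y b) (w j a) (w j' b))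
        ≤ ∑ j' ∈ F.erase j, ∑ b ∈ supp (w j'), 24576 * Ls ^ 2 * (dist (y a) (y b))⁻¹ ^ 8 :=
      Finset.sum_le_sum fun j' hj' => Finset.sum_le_sum fun b hb => hterm j' hj' b hb
    -- the supports of distinct members are disjoint
    have hdisj : Set.PairwiseDisjoint (↑(F.erase j) : Set (Fin N)) (fun j' => supp (w j')) := by
      intro j₁ hj₁ j₂ hj₂ hne
      show Disjoint (supp (w j₁)) (supp (w j₂))
      rw [Finset.disjoint_left]
      intro k hk1 hk2
      have h1 := (hs j₁ (Finset.mem_of_mem_erase hj₁) k (mem_supp.1 hk1)).1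
      have h2 := (hs j₂ (Finset.mem_of_mem_erase hj₂) k (mem_supp.1 hk2)).1
      have h3 := hF j₁ (Finset.mem_of_mem_erase hj₁) j₂ (Finset.mem_of_mem_erase hj₂) hne
      have tri := dist_triangle_left (y j₁) (y j₂) (y k)
      rw [hDsep] at h3
      linarith
    -- collapse the double sum to ONE sum over the partner finset `B`, then to its image in space
    obtain ⟨B, hBdef⟩ : ∃ B : Finset (Fin N), B = (F.erase j).biUnion (fun j' => supp (w j')) := ⟨_, rfl⟩
    have hBprop : ∀ b ∈ B, δ ≤ nearestDist y b ∧ R₀ < dist (y a) (y b) := by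
      intro b hb
      rw [hBdef] at hb
      obtain ⟨j', hj', hb'⟩ := Finset.mem_biUnion.mp hb
      exact hpartner j hj a ha j' hj' b hb'
    have hcollapse : (∑ j' ∈ F.erase j, ∑ b ∈ supp (w j'), 24576 * Ls ^ 2 * (dist (y a) (y b))⁻¹ ^ 8)
        = 24576 * Ls ^ 2 * ∑ b ∈ B, (dist (y a) (y b))⁻¹ ^ 8 := by
      rw [hBdef, Finset.sum_biUnion hdisj, Finset.mul_sum]
      refine Finset.sum_congr rfl fun j' _ => ?_
      rw [Finset.mul_sum]
    have hinjB : Set.InjOn y ↑B := by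
      intro b hb b' hb' hbb
      by_contra hne
      have h1 := nearestDist_le_dist y (Ne.symm hne)
      rw [hbb, dist_self] at h1
      linarith [(hBprop b hb).1]
    have himage : (∑ z ∈ B.image y, (dist (y a) z)⁻¹ ^ 8) = ∑ b ∈ B, (dist (y a) (y b))⁻¹ ^ 8 :=
      Finset.sum_image hinjB
    have htail : (∑ b ∈ B, (dist (y a) (y b))⁻¹ ^ 8) ≤ 250 * δ⁻¹ ^ 3 * R₀⁻¹ ^ 5 := by
      rw [← himage]
      refine tail8_le (B.image y) (y a) hδ hR₀δ ?_ ?_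
      · intro z hz z' hz' hne
        obtain ⟨b, hb, rfl⟩ := Finset.mem_image.mp hz
        obtain ⟨b', hb', rfl⟩ := Finset.mem_image.mp hz'
        have hbb' : b' ≠ b := fun h => hne (by rw [h])
        exact ((hBprop b hb).1).trans (nearestDist_le_dist y hbb')
      · intro z hz
        obtain ⟨b, hb, rfl⟩ := Finset.mem_image.mp hz
        exact (hBprop b hb).2.le
    calc (∑ j' ∈ F.erase j, ∑ b ∈ supp (w j'), mixedDiff (y a - y b) (w j a) (w j' b))
        ≤ ∑ j' ∈ F.erase j, ∑ b ∈ supp (w j'), 24576 * Ls ^ 2 * (dist (y a) (y b))⁻¹ ^ 8 := hsum1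
      _ = 24576 * Ls ^ 2 * ∑ b ∈ B, (dist (y a) (y b))⁻¹ ^ 8 := hcollapse
      _ ≤ 24576 * Ls ^ 2 * (250 * δ⁻¹ ^ 3 * R₀⁻¹ ^ 5) := mul_le_mul_of_nonneg_left htail (by positivity)
      _ = M₁ := by rw [hM₁]
  -- §e  per member: `Σ_{j'} Σ_a Σ_b = Σ_a Σ_{j'} Σ_b ≤ #supp · M₁ ≤ P₁ · M₁ ≤ κ`
  have hmember : ∀ j ∈ F,
      (∑ j' ∈ F.erase j, ∑ a ∈ supp (w j), ∑ b ∈ supp (w j'), mixedDiff (y a - y b) (w j a) (w j' b)) ≤ κ := by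
    intro j hj
    rw [Finset.sum_comm (s := F.erase j) (t := supp (w j))]
    calc (∑ a ∈ supp (w j), ∑ j' ∈ F.erase j, ∑ b ∈ supp (w j'), mixedDiff (y a - y b) (w j a) (w j' b))
        ≤ ∑ a ∈ supp (w j), M₁ := Finset.sum_le_sum fun a ha => hsite j hj a ha
      _ = ((supp (w j)).card : ℝ) * M₁ := by rw [Finset.sum_const, nsmul_eq_mul]
      _ ≤ P₁ * M₁ := mul_le_mul_of_nonneg_right (hcard j hj) hM₁0
      _ ≤ κ := hB
  -- §f  sum over the members
  unfold crossSum
  calc (∑ j ∈ F, ∑ j' ∈ F.erase j, ∑ a ∈ supp (w j), ∑ b ∈ supp (w j'), mixedDiff (y a - y b) (w j a) (w j' b))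
      ≤ ∑ j ∈ F, κ := Finset.sum_le_sum hmember
    _ = κ * (F.card : ℝ) := by rw [Finset.sum_const, nsmul_eq_mul, mul_comm]

/-! ## §7  The assembly: L1 → L2 → L3 → L4 → L5 → `FirmGain` (verbatim from the g106 skeleton) and the theorem -/

/-- **Assembly.**  Fix the window, `κ > 0`, `Ls ≥ 0`, an injective `y`.  `U` = the firm-unstable sites (in-window, so pairwise `≥ δ` apart);
L1 gives a `Dsep`-separated `F ⊆ U` with `#U ≤ P·#F`, `P = (2·Dsep/δ + 1)³`; each member has a destabilising move (`exists_witness_of_not_firmStable`),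
supported within `Ls·nn ≤ 2Ls` of it with amplitude `≤ 2Ls`; the supports are disjoint (`disjoint_supports`), the union move is injective (L4), and by
L3 + L5 `2(E(y + d) − E(y)) ≤ −2κ·#F + κ·#F`; `floor_le` at `y + d` gives `N e⋆ + (κ/2)·#F ≤ E(y)`, hence `N e⋆ + (κ/(2P))·#U ≤ E(y)`:
`CensusW` with `c = κ/(2P)`, `C = 0` (`censusW_of_bare`). -/
theorem firmGain_of_lemmas (L1 : SeparatedSubfamily) (L2 : MixedDiffBound) (L3 : PairSumIdentity) (L4 : JointInjective)
    (L5 : CrossSumBound) : FirmGain := by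
  intro δ hδ hδ2 κ Ls hκ hLs
  have hT0 : 0 ≤ tailLen δ κ Ls := by
    unfold tailLen
    exact Real.rpow_nonneg (by positivity) _
  have hD0 : 0 ≤ Dsep δ κ Ls := by unfold Dsep; positivity
  have h8 : 8 * Ls < Dsep δ κ Ls := by unfold Dsep; linarith
  set D : ℝ := Dsep δ κ Ls with hD
  set P : ℝ := (2 * D / δ + 1) ^ 3 with hP
  have hP0 : 0 < P := by positivity
  refine censusW_of_bare (c := κ / (2 * P)) (by positivity) ?_
  intro N y hy
  -- the firm-unstable sites and their separation
  set U : Finset (Fin N) := Finset.univ.filter fun j => FirmUnstable δ κ Ls y j with hU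
  have hUmem : ∀ j ∈ U, FirmUnstable δ κ Ls y j := fun j hj => (Finset.mem_filter.mp hj).2
  have hUsep : ∀ j ∈ U, ∀ j' ∈ U, j ≠ j' → δ ≤ dist (y j) (y j') := fun j hj j' _ hne =>
    (hUmem j hj).1.1.trans (nearestDist_le_dist y (Ne.symm hne))
  -- L1: a `Dsep`-separated subfamily carrying a fixed fraction of `U`
  obtain ⟨F, hFU, hFsep, hcount⟩ := L1 δ D hδ hD0 N y U hUsep
  -- the destabilising moves of the members
  have hex : ∀ j : Fin N, ∃ d : Fin N → EuclideanSpace ℝ (Fin 3), FirmUnstable δ κ Ls y j → IsFirmWitness δ κ Ls y j d := by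
    intro j
    by_cases hj : FirmUnstable δ κ Ls y j
    · obtain ⟨d, hd⟩ := exists_witness_of_not_firmStable hj.2.2
      exact ⟨d, fun _ => hd⟩
    · exact ⟨0, fun h => absurd h hj⟩
  choose w hw using hex
  have hwF : ∀ j ∈ F, IsFirmWitness δ κ Ls y j (w j) := fun j hj => hw j (hUmem j (hFU hj))
  have hLs2 : ∀ j ∈ F, Ls * nearestDist y j ≤ 2 * Ls := by
    intro j hj
    have h2 : nearestDist y j ≤ 2 := (hUmem j (hFU hj)).1.2
    have h3 : Ls * nearestDist y j ≤ Ls * 2 := mul_le_mul_of_nonneg_left h2 hLs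
    linarith
  have hsuppF : ∀ j ∈ F, ∀ k : Fin N, w j k ≠ 0 → dist (y k) (y j) ≤ 2 * Ls ∧ InWindow δ 2 y k := by
    intro j hj k hk
    obtain ⟨h1, h2⟩ := (hwF j hj).1 k hk
    exact ⟨h1.trans (hLs2 j hj), h2⟩
  have hampF : ∀ j ∈ F, ∀ k : Fin N, ‖w j k‖ ≤ 2 * Ls := fun j hj k => ((hwF j hj).2.1 k).trans (hLs2 j hj)
  have hinjF : ∀ j ∈ F, Function.Injective (y + w j) := fun j hj => (hwF j hj).2.2.1
  have hdropF : ∀ j ∈ F, interactionEnergy lennardJones (y + w j) + κ < interactionEnergy lennardJones y :=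
    fun j hj => (hwF j hj).2.2.2
  have hsep8 : ∀ j ∈ F, ∀ j' ∈ F, j ≠ j' → 8 * Ls < dist (y j) (y j') :=
    fun j hj j' hj' hne => h8.trans (hFsep j hj j' hj' hne)
  have hdisj := disjoint_supports hLs (fun j hj k hk => (hsuppF j hj k hk).1) hsep8
  -- the simultaneous move: injective (L4), exact pair sum (L3), cross terms ≤ κ·#F (L5 with L2)
  have hinj : Function.Injective (y + ∑ j ∈ F, w j) :=
    L4 Ls hLs N y hy F w hinjF (fun j hj k hk => (hsuppF j hj k hk).1) hampF hsep8
  have hid := L3 N y F w hdisj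
  have hcross : crossSum y w F ≤ κ * (F.card : ℝ) := L5 L2 δ κ Ls hδ hδ2 hκ hLs N y F w hsuppF hampF hFsep
  have hmem : ∑ j ∈ F, (interactionEnergy lennardJones (y + w j) - interactionEnergy lennardJones y) ≤ ∑ j ∈ F, (-κ) :=
    Finset.sum_le_sum fun j hj => by linarith [hdropF j hj]
  rw [Finset.sum_const, nsmul_eq_mul] at hmem
  -- the floor at the moved injective configuration
  have hfloor := floor_le hinj
  -- counting: `cnt y = #U ≤ P·#F`
  have hcnt : (firmUnstableCount δ κ Ls y : ℝ) = (U.card : ℝ) := by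
    rw [firmUnstableCount_eq_card]
  have hcU : κ / (2 * P) * (U.card : ℝ) ≤ κ / 2 * (F.card : ℝ) := by
    calc κ / (2 * P) * (U.card : ℝ) ≤ κ / (2 * P) * (P * (F.card : ℝ)) :=
          mul_le_mul_of_nonneg_left hcount (by positivity)
      _ = κ / 2 * (F.card : ℝ) := by field_simp
  show (N : ℝ) * (⨅ Q : PeriodicConfiguration 3, Q.energyPerParticle lennardJones) + κ / (2 * P) * (firmUnstableCount δ κ Ls y : ℝ)
      ≤ interactionEnergy lennardJones y
  rw [hcnt]
  linarith

/-- **`FirmGain` holds** — the (2c) payer leaf of the 31280 line, by name. -/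
theorem firmGain : FirmGain :=
  firmGain_of_lemmas separatedSubfamily mixedDiffBound pairSumIdentity jointInjective crossSumBound


/-- ★ **`SoftGain`** ((429) `…OverbindingBudgetAffineStableDescent.SoftGain`, the (2c) payer of record before crit-1 r1934) follows from `firmGain` by
(464) `softGain_of_firmGain` — so both (2c) payer statements of line 31280 (`OverbindingBudget…`, stmt-AtomisticToContinuum-31280) are now theorems. -/
theorem softGain : Summit.AtomisticToContinuum.Crystallization.Theorems.OverbindingBudgetAffineStableDescent.SoftGain :=
  softGain_of_firmGain firmGain

end Summit.AtomisticToContinuum.Crystallization.Theorems.OverbindingBudgetAffineFirmDescent.Brief
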